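import Mathlib.Analysis.Complex.Liouville
import Mathlib.Analysis.Complex.CauchyIntegral
import Mathlib.Analysis.Calculus.IteratedDeriv.Lemmas
import Mathlib.RingTheory.PowerSeries.Substitution
import Literature.NumberTheory.EllipticCurves.FormalGroupDenominators
import HarnessLib

/-!
# André's algebraicity criterion over `ℚ`, II: the Schwarz-lemma bound on the jump functionals
# (Chambert-Loir, Sém. Bourbaki 886, §6.5–6.6 and Lemma 6.4; proofs only)

Topic `Literature/NumberTheory/Transcendental`. Second of three files proving, for `K = ℚ`, the
algebraicity criterion of André (2004, Thm. 2.3.1) in the form of A. Chambert-Loir, Sém. Bourbaki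
886, Astérisque 282 (2002), Thm. 6.2 (first part), on the way to Bost's Faltings-free proof of the
isogeny theorem for elliptic curves over `ℚ` (Publ. Math. IHÉS 93 (2001), Thm. 2.3, Cor. 2.5).

This file is the archimedean estimate (6.6.1): the bound `h_∞(φ⁽ⁿ⁾) ≤ -n log R'_∞ + (d + D)C`
on the `n`-th jump functional `P ↦ [xⁿ] P(x, y(x))` restricted to the polynomials `P` of
bidegree `≤ (d, D)` with `P(x, y(x)) = O(xⁿ)`, obtained from a simultaneous archimedean
uniformisation of `(x, y)`: meromorphic `φ = F/g`, `ψ = G/g` on the disc `D(0, R)` with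
`φ(0) = 0`, `φ'(0) = 1` and `y(φ(z)) = ψ(z)` as germs (Chambert-Loir §6.1, 6.5–6.6). Following the
printed proof: for such `P = Σ P_{ab} Xᵃ Yᵇ`, the function
`h = g^{d+D} P(φ, ψ) = Σ P_{ab} Fᵃ g^{d-a} Gᵇ g^{D-b}` is analytic on the disc, its Taylor series
at `0` is `ĝ^{d+D} · P(x, y(x))|_{x = φ̂}`, whose `n`-th coefficient is `[xⁿ] P(x, y(x))` because
`φ̂ = z + O(z²)` and `g(0) = 1`; and Cauchy's estimate (Schwarz's lemma, Chambert-Loir Lemma 6.4)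
bounds the `n`-th Taylor coefficient of `h` by `‖h‖_{R'} R'⁻ⁿ ≤ (Σ|P_{ab}|) M^{d+D} R'⁻ⁿ`.

* Taylor series at `0` as formal power series: written out as
  `PowerSeries.mk fun n => (n!)⁻¹ · iteratedDeriv n f 0` (local notation `𝓣[f]`; no definition is
  introduced), with its calculus on germs of analytic functions — `taylor_congr`, `taylor_add`,
  `taylor_sum`, `taylor_const_mul`, `taylor_mul` (Leibniz, Mathlib `iteratedDeriv_mul`),
  `taylor_pow`, `constantCoeff_taylor`, `coeff_one_taylor` — and **Cauchy's estimate**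
  `norm_coeff_taylor_le` (Mathlib `Complex.norm_iteratedDeriv_le_of_forall_mem_sphere_norm_le`);
* the formal bookkeeping: `coeff_mul_of_coeff_lt_eq_zero`, `coeff_subst_of_coeff_lt_eq_zero`
  (`[xⁿ] S(φ̂) = [xⁿ] S` when `S = O(xⁿ)` and `φ̂ = x + O(x²)`), `subst_sum_C_mul_X_pow_mul_pow`
  (`P(x, y)|_{x=φ̂} = P(φ̂, y(φ̂))`);
* **`norm_coeff_le_of_coeff_lt_eq_zero`** — the estimate (6.6.1) itself, in the coefficient form
  consumed by part III: `‖[xⁿ] P(x, y(x))‖ ≤ (Σ ‖P_{ab}‖) · M^{d+D} / R'ⁿ`.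

## Sources

* A. Chambert-Loir, Sém. Bourbaki 886, Astérisque 282 (2002) = arXiv:math/0103192: §6.1
  (uniformisation simultanée), Lemma 6.4 (Schwarz), §6.5 (trivial uniformisation, `h = g^D P`),
  (6.5.1), §6.6 and (6.6.1). [ChambertLoir2002Bourbaki]
* Y. André, in: Geometric aspects of Dwork theory (2004), Thm. 2.3.1. [Andre2004pCourbures]
* J.-B. Bost, Publ. Math. IHÉS 93 (2001), §2.3, §4.2–4.3. [Bost2001AlgebraicLeaves]

## Design notes

Theorems only; the Taylor series at `0` is a local notation, not a definition. Meromorphy of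
`φ, ψ` is taken in the pole-cleared form in which it is used (as in the tree's
`Literature.NumberTheory.Transcendental.Borel.exists_polynomial_mul_eq_of_meromorphic`): analytic
`g, F, G` on the disc with `F = g·φ`, `G = g·ψ` near `0` and `g(0) = 1`. The constant-term lemma
for substitution is the tree's
`Literature.NumberTheory.EllipticCurves.constantCoeff_subst_of_constantCoeff_eq_zero`.
-/

noncomputable section

open PowerSeries Metric Filter Finset
open scoped Topology Nat

namespace Literature.NumberTheory.Transcendental

namespace AndreCriterion

/-- The Taylor series of `f : ℂ → ℂ` at `0`, as a formal power series (local notation). -/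
local notation3 "𝓣[" f "]" =>
  (PowerSeries.mk fun n => ((Nat.factorial n : ℂ)⁻¹ * iteratedDeriv n f 0) : PowerSeries ℂ)

/-! ### Taylor series at `0` of germs of analytic functions -/

section Taylor

variable {f g : ℂ → ℂ}

/-- The coefficients of the Taylor series. [folklore] -/
theorem coeff_taylor (f : ℂ → ℂ) (n : ℕ) :
    coeff n 𝓣[f] = ((n ! : ℂ))⁻¹ * iteratedDeriv n f 0 :=
  coeff_mk _ _

/-- The constant term of the Taylor series is `f 0`. [folklore] -/
theorem constantCoeff_taylor (f : ℂ → ℂ) : constantCoeff 𝓣[f] = f 0 := by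
  rw [← coeff_zero_eq_constantCoeff_apply, coeff_taylor]
  simp

/-- The linear term of the Taylor series is `f' 0`. [folklore] -/
theorem coeff_one_taylor (f : ℂ → ℂ) : coeff 1 𝓣[f] = deriv f 0 := by
  rw [coeff_taylor]
  simp

/-- The Taylor series only depends on the germ at `0`. [folklore] -/
theorem taylor_congr (h : f =ᶠ[𝓝 0] g) : 𝓣[f] = 𝓣[g] := by
  ext n
  rw [coeff_taylor, coeff_taylor, h.iteratedDeriv_eq n]

/-- Additivity of the Taylor series. [folklore] -/
theorem taylor_add (hf : AnalyticAt ℂ f 0) (hg : AnalyticAt ℂ g 0) :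
    𝓣[f + g] = 𝓣[f] + 𝓣[g] := by
  ext n
  rw [map_add, coeff_taylor, coeff_taylor, coeff_taylor,
    iteratedDeriv_add hf.contDiffAt hg.contDiffAt, mul_add]

/-- The Taylor series of a finite sum. [folklore] -/
theorem taylor_sum {α : Type*} (s : Finset α) {f : α → ℂ → ℂ}
    (hf : ∀ i ∈ s, AnalyticAt ℂ (f i) 0) :
    𝓣[∑ i ∈ s, f i] = ∑ i ∈ s, 𝓣[f i] := by
  ext n
  rw [coeff_taylor, map_sum, iteratedDeriv_sum fun i hi => (hf i hi).contDiffAt, Finset.mul_sum]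
  refine Finset.sum_congr rfl fun i _ => ?_
  rw [coeff_taylor]

/-- The Taylor series of `c · f`. [folklore] -/
theorem taylor_const_mul (c : ℂ) (f : ℂ → ℂ) :
    𝓣[fun z => c * f z] = C c * 𝓣[f] := by
  ext n
  rw [coeff_taylor, coeff_C_mul, coeff_taylor, iteratedDeriv_const_mul_field]
  ring

/-- **Multiplicativity of the Taylor series** (Leibniz's rule,
`(fg)⁽ⁿ⁾/n! = Σ_{i+j=n} f⁽ⁱ⁾/i! · g⁽ʲ⁾/j!`). [folklore] -/
theorem taylor_mul (hf : AnalyticAt ℂ f 0) (hg : AnalyticAt ℂ g 0) :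
    𝓣[f * g] = 𝓣[f] * 𝓣[g] := by
  ext n
  rw [coeff_taylor, coeff_mul, iteratedDeriv_mul hf.contDiffAt hg.contDiffAt,
    Finset.Nat.sum_antidiagonal_eq_sum_range_succ_mk, Finset.mul_sum]
  refine Finset.sum_congr rfl fun i hi => ?_
  rw [coeff_taylor, coeff_taylor]
  have hi' : i ≤ n := Nat.lt_succ_iff.mp (Finset.mem_range.mp hi)
  have key : ((n.choose i : ℕ) : ℂ) * (i ! : ℂ) * ((n - i)! : ℂ) = (n ! : ℂ) := by
    exact_mod_cast Nat.choose_mul_factorial_mul_factorial hi'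
  have hn0 : (n ! : ℂ) ≠ 0 := by exact_mod_cast Nat.factorial_ne_zero n
  have hi0 : (i ! : ℂ) ≠ 0 := by exact_mod_cast Nat.factorial_ne_zero i
  have hni0 : ((n - i)! : ℂ) ≠ 0 := by exact_mod_cast Nat.factorial_ne_zero (n - i)
  have hchoose : ((n.choose i : ℕ) : ℂ) = (n ! : ℂ) * ((i ! : ℂ))⁻¹ * (((n - i)! : ℂ))⁻¹ := by
    rw [← key]
    field_simp
  rw [hchoose]
  field_simp

/-- The Taylor series of the constant function `1`. [folklore] -/
theorem taylor_one : 𝓣[(1 : ℂ → ℂ)] = 1 := by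
  ext n
  rw [coeff_taylor, Pi.one_def, iteratedDeriv_const, coeff_one]
  split_ifs with h
  · subst h; simp
  · simp

/-- The Taylor series of a power. [folklore] -/
theorem taylor_pow (hf : AnalyticAt ℂ f 0) (k : ℕ) : 𝓣[f ^ k] = 𝓣[f] ^ k := by
  induction k with
  | zero => rw [pow_zero, pow_zero, taylor_one]
  | succ k ih => rw [pow_succ, taylor_mul (hf.pow k) hf, ih, pow_succ]

/-- **Cauchy's estimate for the Taylor coefficients** (Chambert-Loir, Lemma 6.4: for `f` bounded
analytic on `D(0, R')`, `|f⁽ⁿ⁾(0)/n!| ≤ R'⁻ⁿ ‖f‖_{R'}`), from Mathlib's Cauchy estimate for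
`iteratedDeriv`. [cite: ChambertLoir2002Bourbaki, Lemma 6.4] -/
theorem norm_coeff_taylor_le {r B : ℝ} (hr : 0 < r) (hf : DiffContOnCl ℂ f (ball 0 r))
    (hB : ∀ z ∈ sphere (0 : ℂ) r, ‖f z‖ ≤ B) (n : ℕ) :
    ‖coeff n 𝓣[f]‖ ≤ B / r ^ n := by
  rw [coeff_taylor, norm_mul, norm_inv, Complex.norm_natCast]
  have h := Complex.norm_iteratedDeriv_le_of_forall_mem_sphere_norm_le n hr hf hB
  have hn : (0 : ℝ) < n ! := by exact_mod_cast Nat.factorial_pos n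
  rw [inv_mul_le_iff₀ hn]
  calc ‖iteratedDeriv n f 0‖ ≤ n ! * B / r ^ n := h
    _ = (n ! : ℝ) * (B / r ^ n) := by ring

end Taylor

/-! ### Formal bookkeeping -/

section Formal

variable {A : Type*} [CommRing A]

/-- If `S = O(Xᵐ)` then `[Xᵐ](B·S) = B(0)·[Xᵐ]S`. [folklore] -/
theorem coeff_mul_of_coeff_lt_eq_zero {S : A⟦X⟧} {m : ℕ} (hS : ∀ m' < m, coeff m' S = 0)
    (B : A⟦X⟧) : coeff m (B * S) = constantCoeff B * coeff m S := by
  rw [coeff_mul, Finset.Nat.sum_antidiagonal_eq_sum_range_succ_mk, Finset.sum_eq_single 0]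
  · simp
  · intro k hk hk0
    have hlt : m - k < m := by
      have := Finset.mem_range.mp hk
      omega
    dsimp only
    rw [hS _ hlt, mul_zero]
  · intro h
    exact absurd (Finset.mem_range.mpr (Nat.succ_pos m)) h

/-- **`[xᵐ'] S(a) = 0` for `m' < m` and `[xᵐ] S(a) = [xᵐ] S` when `S = O(xᵐ)` and
`a = x + O(x²)`** (the leading coefficient of `P(x, y(x))` is that of `P(φ(z), ψ(z))`,
Chambert-Loir §6.5: "`φ⁽ⁿ⁾(P) = (1/n!) ∂ⁿ/∂xⁿ h(x)|_{x=0}`"). [cite: ChambertLoir2002Bourbaki, §6.5] -/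
theorem coeff_subst_of_coeff_lt_eq_zero {S a : A⟦X⟧} (ha0 : constantCoeff a = 0)
    (ha1 : coeff 1 a = 1) {m : ℕ} (hS : ∀ m' < m, coeff m' S = 0) :
    (∀ m' < m, coeff m' (S.subst a) = 0) ∧ coeff m (S.subst a) = coeff m S := by
  have has : HasSubst a := HasSubst.of_constantCoeff_zero' ha0
  obtain ⟨Q, hQ⟩ : X ^ m ∣ S := X_pow_dvd_iff.mpr hS
  set u : A⟦X⟧ := PowerSeries.mk fun n => coeff (n + 1) a with hu
  have hau : a = X * u := by
    ext n
    cases n with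
    | zero => rw [coeff_zero_X_mul, coeff_zero_eq_constantCoeff_apply, ha0]
    | succ n => rw [coeff_succ_X_mul, hu, coeff_mk]
  have hu0 : constantCoeff u = 1 := by
    rw [← coeff_zero_eq_constantCoeff_apply, hu, coeff_mk, zero_add, ha1]
  have hpow : a ^ m = X ^ m * u ^ m := by rw [hau, mul_pow]
  have hsub : S.subst a = X ^ m * (u ^ m * Q.subst a) := by
    rw [hQ, subst_mul has, subst_pow has, subst_X has, hpow, mul_assoc]
  have hQ0 : coeff m S = constantCoeff Q := by
    rw [hQ, coeff_X_pow_mul', if_pos le_rfl, Nat.sub_self, coeff_zero_eq_constantCoeff_apply]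
  constructor
  · intro m' hm'
    rw [hsub, coeff_X_pow_mul', if_neg (not_le.mpr hm')]
  · rw [hsub, coeff_X_pow_mul', if_pos le_rfl, Nat.sub_self, coeff_zero_eq_constantCoeff_apply,
      map_mul, map_pow, hu0, one_pow, one_mul,
      Literature.NumberTheory.EllipticCurves.constantCoeff_subst_of_constantCoeff_eq_zero ha0, hQ0]

/-- **`P(x, y)|_{x = t} = P(t, y(t))`** for `t = O(x)`: substitution is a ring homomorphism
fixing constants. [folklore] -/
theorem subst_sum_C_mul_X_pow_mul_pow {ι : Type*} (s : Finset ι) (c : ι → A) (ea eb : ι → ℕ)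
    (y : A⟦X⟧) {t : A⟦X⟧} (ht0 : constantCoeff t = 0) :
    (∑ i ∈ s, C (c i) * (X ^ ea i * y ^ eb i)).subst t =
      ∑ i ∈ s, C (c i) * (t ^ ea i * (y.subst t) ^ eb i) := by
  have hts : HasSubst t := HasSubst.of_constantCoeff_zero' ht0
  rw [← coe_substAlgHom hts, map_sum]
  refine Finset.sum_congr rfl fun i _ => ?_
  rw [map_mul, map_mul, map_pow, map_pow, substAlgHom_X, C_eq_algebraMap, AlgHom.commutes]

end Formal

/-! ### The archimedean estimate (6.6.1) -/

section Estimate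

variable {g F G φf ψf : ℂ → ℂ} {R r M : ℝ}

/-- Products of four bounded factors: `|Fᵃ g^{d-a} Gᵇ g^{D-b}| ≤ M^{d+D}` on the circle when
`|F|, |g|, |G| ≤ M` there and `M ≥ 1`. [folklore] -/
theorem norm_prod_four_le (hM : 1 ≤ M) {z : ℂ} (hgz : ‖g z‖ ≤ M) (hFz : ‖F z‖ ≤ M)
    (hGz : ‖G z‖ ≤ M) {d D a b : ℕ} (ha : a ≤ d) (hb : b ≤ D) :
    ‖F z ^ a * g z ^ (d - a) * G z ^ b * g z ^ (D - b)‖ ≤ M ^ (d + D) := by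
  have hM0 : 0 ≤ M := zero_le_one.trans hM
  rw [norm_mul, norm_mul, norm_mul, norm_pow, norm_pow, norm_pow, norm_pow]
  calc ‖F z‖ ^ a * ‖g z‖ ^ (d - a) * ‖G z‖ ^ b * ‖g z‖ ^ (D - b)
      ≤ M ^ a * M ^ (d - a) * M ^ b * M ^ (D - b) := by
        gcongr
    _ = M ^ (d + D) := by
        rw [← pow_add, ← pow_add, ← pow_add]
        congr 1
        omega

/-- **Chambert-Loir (6.6.1), coefficient form.** Let `g, F, G` be analytic on `|z| < R` with
`g(0) = 1`, and let `φ, ψ` be analytic germs at `0` with `F = g·φ`, `G = g·ψ` near `0`,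
`φ(0) = 0`, `φ'(0) = 1` (a simultaneous archimedean uniformisation `(φ, ψ) = (F/g, G/g)` of
`(x, y)` on `D(0, R)`, Chambert-Loir §6.1) and `y(φ̂) = ψ̂` for a formal power series `y`.
If `0 < R' < R` and `|g|, |F|, |G| ≤ M` (`M ≥ 1`) on `|z| = R'`, then for every family of
coefficients `P_{ab}` (`a ≤ d`, `b ≤ D`) such that `S = Σ P_{ab} xᵃ y(x)ᵇ = O(xᵐ)`:
`‖[xᵐ] S‖ ≤ (Σ ‖P_{ab}‖) · M^{d+D} / R'ᵐ`. Proof (Chambert-Loir §6.5–6.6):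
`h = Σ P_{ab} Fᵃ g^{d-a} Gᵇ g^{D-b}` is analytic on the disc with Taylor series
`ĝ^{d+D} · S(φ̂)`, whose `m`-th coefficient is `[xᵐ] S`; Cauchy's estimate (Lemma 6.4) bounds
it by `‖h‖_{R'} R'⁻ᵐ`. [cite: ChambertLoir2002Bourbaki, §6.5–6.6, (6.6.1)] -/
theorem norm_coeff_le_of_coeff_lt_eq_zero (hR : 0 < R) (hr : 0 < r) (hrR : r < R) (hM : 1 ≤ M)
    (hg : DifferentiableOn ℂ g (ball 0 R)) (hF : DifferentiableOn ℂ F (ball 0 R))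
    (hG : DifferentiableOn ℂ G (ball 0 R)) (hφ : AnalyticAt ℂ φf 0) (hψ : AnalyticAt ℂ ψf 0)
    (hFg : F =ᶠ[𝓝 0] g * φf) (hGg : G =ᶠ[𝓝 0] g * ψf) (hg0 : g 0 = 1)
    (hφ0 : φf 0 = 0) (hφ1 : deriv φf 0 = 1)
    (hgM : ∀ z ∈ sphere (0 : ℂ) r, ‖g z‖ ≤ M) (hFM : ∀ z ∈ sphere (0 : ℂ) r, ‖F z‖ ≤ M)
    (hGM : ∀ z ∈ sphere (0 : ℂ) r, ‖G z‖ ≤ M)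
    {y : PowerSeries ℂ} (hy : y.subst 𝓣[φf] = 𝓣[ψf])
    {d D : ℕ} (P : Fin (d + 1) × Fin (D + 1) → ℂ) {m : ℕ}
    (hP : ∀ m' < m,
      coeff m' (∑ ab, C (P ab) * (X ^ (ab.1 : ℕ) * y ^ (ab.2 : ℕ))) = 0) :
    ‖coeff m (∑ ab, C (P ab) * (X ^ (ab.1 : ℕ) * y ^ (ab.2 : ℕ)))‖ ≤
      (∑ ab, ‖P ab‖) * M ^ (d + D) / r ^ m := by
  -- analyticity at `0`
  have hball : ball (0 : ℂ) R ∈ 𝓝 (0 : ℂ) := ball_mem_nhds 0 hR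
  have hga : AnalyticAt ℂ g 0 := hg.analyticAt hball
  have hFa : AnalyticAt ℂ F 0 := hF.analyticAt hball
  have hGa : AnalyticAt ℂ G 0 := hG.analyticAt hball
  -- the Taylor series of `φ`
  have hφc0 : constantCoeff 𝓣[φf] = 0 := by rw [constantCoeff_taylor, hφ0]
  have hφc1 : coeff 1 𝓣[φf] = 1 := by rw [coeff_one_taylor, hφ1]
  have hTF : 𝓣[F] = 𝓣[g] * 𝓣[φf] := by rw [taylor_congr hFg, taylor_mul hga hφ]
  have hTG : 𝓣[G] = 𝓣[g] * 𝓣[ψf] := by rw [taylor_congr hGg, taylor_mul hga hψ]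
  -- the auxiliary analytic function `h`
  set S : PowerSeries ℂ := ∑ ab, C (P ab) * (X ^ (ab.1 : ℕ) * y ^ (ab.2 : ℕ)) with hS
  set h : ℂ → ℂ := ∑ ab : Fin (d + 1) × Fin (D + 1),
    fun z => P ab * (F ^ (ab.1 : ℕ) * g ^ (d - ab.1) * G ^ (ab.2 : ℕ) * g ^ (D - ab.2)) z
    with hh
  have hterm_an : ∀ ab : Fin (d + 1) × Fin (D + 1), AnalyticAt ℂ
      (fun z => P ab * (F ^ (ab.1 : ℕ) * g ^ (d - ab.1) * G ^ (ab.2 : ℕ) * g ^ (D - ab.2)) z)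
        0 := by
    intro ab
    exact analyticAt_const.mul (((hFa.pow _).mul (hga.pow _)).mul (hGa.pow _) |>.mul (hga.pow _))
  -- its Taylor series
  have hTh : 𝓣[h] = 𝓣[g] ^ (d + D) * S.subst 𝓣[φf] := by
    rw [hh, taylor_sum _ fun ab _ => hterm_an ab, hS,
      subst_sum_C_mul_X_pow_mul_pow _ _ _ _ y hφc0, hy, Finset.mul_sum]
    refine Finset.sum_congr rfl fun ab _ => ?_
    rw [taylor_const_mul, taylor_mul (((hFa.pow _).mul (hga.pow _)).mul (hGa.pow _)) (hga.pow _),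
      taylor_mul ((hFa.pow _).mul (hga.pow _)) (hGa.pow _), taylor_mul (hFa.pow _) (hga.pow _),
      taylor_pow hFa, taylor_pow hga, taylor_pow hGa, taylor_pow hga, hTF, hTG]
    have ha : (ab.1 : ℕ) ≤ d := Nat.lt_succ_iff.mp ab.1.2
    have hb : (ab.2 : ℕ) ≤ D := Nat.lt_succ_iff.mp ab.2.2
    set Tg := 𝓣[g]
    set Tφ := 𝓣[φf]
    set Tψ := 𝓣[ψf]
    have key : (Tg * Tφ) ^ (ab.1 : ℕ) * Tg ^ (d - ab.1) * (Tg * Tψ) ^ (ab.2 : ℕ) *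
        Tg ^ (D - ab.2) = Tg ^ (d + D) * (Tφ ^ (ab.1 : ℕ) * Tψ ^ (ab.2 : ℕ)) := by
      have h1 : Tg ^ (d + D) = Tg ^ (ab.1 : ℕ) * Tg ^ (d - ab.1) *
          (Tg ^ (ab.2 : ℕ) * Tg ^ (D - ab.2)) := by
        rw [← pow_add, ← pow_add, ← pow_add]
        congr 1
        omega
      rw [h1, mul_pow, mul_pow]
      ring
    rw [key, ← mul_assoc, mul_comm (C (P ab)) (Tg ^ (d + D)), mul_assoc]
  -- its `m`-th coefficient
  obtain ⟨hlow, hcoeff⟩ := coeff_subst_of_coeff_lt_eq_zero hφc0 hφc1 hP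
  have hcm : coeff m 𝓣[h] = coeff m S := by
    rw [hTh, coeff_mul_of_coeff_lt_eq_zero hlow, hcoeff, map_pow, constantCoeff_taylor, hg0,
      one_pow, one_mul]
  -- `h` on the closed disc of radius `r`
  have hdiff_term : ∀ ab : Fin (d + 1) × Fin (D + 1), DifferentiableOn ℂ
      (fun z => P ab * (F ^ (ab.1 : ℕ) * g ^ (d - ab.1) * G ^ (ab.2 : ℕ) * g ^ (D - ab.2)) z)
        (ball 0 R) := by
    intro ab
    refine (differentiableOn_const _).mul ?_
    exact (((hF.pow _).mul (hg.pow _)).mul (hG.pow _)).mul (hg.pow _)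
  have hdiff : DifferentiableOn ℂ h (ball 0 R) := by
    rw [hh]
    exact DifferentiableOn.sum fun ab _ => hdiff_term ab
  have hdcc : DiffContOnCl ℂ h (ball 0 r) :=
    hdiff.diffContOnCl_ball (closedBall_subset_ball hrR)
  have hbound : ∀ z ∈ sphere (0 : ℂ) r, ‖h z‖ ≤ (∑ ab, ‖P ab‖) * M ^ (d + D) := by
    intro z hz
    rw [hh, Finset.sum_apply, Finset.sum_mul]
    refine (norm_sum_le _ _).trans (Finset.sum_le_sum fun ab _ => ?_)
    rw [norm_mul]
    refine mul_le_mul_of_nonneg_left ?_ (norm_nonneg _)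
    simp only [Pi.mul_apply, Pi.pow_apply]
    exact norm_prod_four_le hM (hgM z hz) (hFM z hz) (hGM z hz)
      (Nat.lt_succ_iff.mp ab.1.2) (Nat.lt_succ_iff.mp ab.2.2)
  -- Cauchy's estimate
  rw [← hcm]
  exact norm_coeff_taylor_le hr hdcc hbound m

end Estimate

end AndreCriterion

end Literature.NumberTheory.Transcendental
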